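import Summits.CriticalPhenomena.SAWScalingLimit.Theses.SAWDevelopingMap
import Summits.CriticalPhenomena.SAWScalingLimit.Theorems.ObservableToSLE.Negative.FloorRatioLimitRootPinning_Lattice
import Summits.CriticalPhenomena.SAWScalingLimit.Theorems.ObservableToSLE.Negative.FloorRatioLimitRootPinning_HalfDisc
import Summits.CriticalPhenomena.SAWScalingLimit.Theorems.ObservableToSLE.Negative.FloorClassNonVacuity

/-!
# The repaired antecedent `HexObservableLimit` (rev 4, item stmt-CriticalPhenomena-14003) has an
inhabited hypothesis class (crux `ObservableToSLE`, stmt-CriticalPhenomena-10472; cdisprove cycle 4)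

Negative/structural lemma (refuter).  Since rev 4 (2026-08-16) the first hypothesis of the crux
`ObservableToSLE : HexObservableLimit → HexTight → HexConjecture` pins the ROOT conformally as well:
flat horizontal boundary pieces and exact half-lattice rows (`m : Fin 2 → ℝ → ℤ`) in the `ρ`-balls at
BOTH marked points.  If that longer hypothesis list were unsatisfiable, `HexObservableLimit` would be
TRIVIALLY true (any `c ≠ 0` works), the route target would close for the wrong reason, and on the
picked line `floor-ratio-restriction-bootstrap` the stubs consuming it (`stub_targetTransport`,
`stub_restrictionCocycle`) would carry no information while all content silently moved into
`stub_canonicalTransfer`.  This file rules that out with a CHECKED instance, built on the corridor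
modules `BoundaryClosureNegative_*`, on the drefute seat's `FloorRatioLimitRootPinning_*` (`bEdgeQ`,
`Nc`, flatness at real points) and on `FloorClassNonVacuity` (`quarter_mem`, `flat_quarter`):

* root = the vertical FLOOR mid-edge `bEdgeQ (Nc δ)` below the row-`0` face of cell `Nc δ = ⌊1/(4δ)⌋`
  (midpoint `→ 1/4`), normalisation edge `bEdge` (midpoint `→ 0`), discretisation `Lam δ false` (the
  body of the corridor refutation: exact half-lattice in `B(0, 1/2) ⊇ B(1/4, 1/4) ∪ B(0, 1/4)`),
  domain `(HD; 1/4, 0)` = `halfDiscDomain (1/4)`, `ρ = 1/4`, rows `m ≡ 0`, `Φ = Φ_{1/4}` (`PhiCE`),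
  `L = Lfun (1/4)`, `Lb = Lfun (1/4) 0`;
* `floorInstance_hypotheses`: EVERY inner hypothesis of the rev-4 statement holds for this family
  (flatness at both marked points, simple connectivity, boundary mid-edges, a self-avoiding walk
  root `→ bEdge` along row `0` (`nonempty_floorSAW`), connectivity, centres in `HD`, exact rows in BOTH
  balls, exhaustion of compacts, convergence of the marked mid-edges, `‖Φ‖ → ∞` at the root, boundary
  value `0` at `0`, the logarithm of `Φ'` and its limit);
* `hexObservableLimit_hypotheses_inhabited`: hence the hypothesis class of item 14003 is inhabited (with
  the root on a FLOOR mid-edge — the floor class of the live `ObservableToSLE` lines; `ψ = 0`);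
* `floorInstance_of_hexObservableLimit`: `HexObservableLimit` yields, for its universal `c ≠ 0` and
  every bump `ψ` of `HD`, the concrete limit
  `δ² Σ_e ψ(δ e) F_δ(e) / F_δ(bEdge) → c ∫ ψ exp((5/8)(L_{1/4} − L_{1/4}(0)))` for this floor-rooted
  family — the typed instance any second refutation of item 14003 would have to pair with a competing
  one (Disproof.lean §8.3: no exact lattice identity produces such a pair once both balls are rigid).
-/

noncomputable section

open Set Filter Topology Complex
open Literature.Probability.RandomPlanarGeometry
open UpperHalfPlane (upperHalfPlaneSet)
open Literature.Probability.LatticeModels Literature.Probability.RandomPlanarGeometry.SAW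
open Summit.CriticalPhenomena.SAWScalingLimit.Theorems.BoundaryClosure.Negative

namespace Summit.CriticalPhenomena.SAWScalingLimit.Theorems.ObservableToSLE.Negative

/-! ### The floor root edge `bEdgeQ (Nc δ)` as a ROOT of the body `Lam δ false` -/

section Geometry

variable {δ : ℝ} (hδ : 0 < δ) (hδ' : δ ≤ 1 / 16)
include hδ hδ'

/-- The inner face `fj (2 Nc) 0` of the floor root edge is a vertex of the body. [folklore] -/
theorem fj_two_Nc_mem : fj (2 * Nc δ) 0 ∈ Lam δ false := by
  obtain ⟨h1, h2⟩ := Nc_pos_lt_Xc hδ hδ'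
  refine fj_row_zero_mem hδ hδ' false (by omega) ?_
  show 2 * Nc δ ≤ 2 * rootCell δ false + 1
  unfold rootCell; simp only [Bool.false_eq_true, ↓reduceIte]; omega

/-- **A self-avoiding walk from the floor root edge to the normalisation edge**: the straight walk
`fj (2 Nc) 0, …, fj 0 0` along row `0` (entering through the vertical edge below `fj (2 Nc) 0`,
leaving through the vertical edge `bEdge` below `fj 0 0`). [folklore] -/
theorem nonempty_floorSAW : Nonempty (HexMidEdgeSAW (Lam δ false) (bEdgeQ (Nc δ)) bEdge) := by
  obtain ⟨h1, h2⟩ := Nc_pos_lt_Xc hδ hδ'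
  obtain ⟨N, hN⟩ : ∃ N : ℕ, (N : ℤ) = Nc δ := ⟨(Nc δ).toNat, by omega⟩
  have hΛ : ∀ i : ℕ, i ≤ 2 * N → fj i 0 ∈ Lam δ false := fun i hi =>
    fj_row_zero_mem hδ hδ' false (by omega) (by
      show (i : ℤ) ≤ 2 * rootCell δ false + 1
      unfold rootCell; simp only [Bool.false_eq_true, ↓reduceIte]; omega)
  have hmem : ∀ e ∈ List.zipWith (fun u w => s(u, w)) (rowWalk (2 * N)) (rowWalk (2 * N)).tail,
      ∀ c ∈ e, ∃ i : ℕ, i ≤ 2 * N ∧ c = fj i 0 := fun e he c hc =>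
    mem_rowWalk.1 (forall_mem_of_mem_edges _ e he c hc)
  have hout : ∀ i : ℕ, fj (2 * Nc δ + 1) (-1) ≠ fj i 0 := fun i h => by
    have := (fj_inj.1 h).2; omega
  have hout' : ∀ i : ℕ, fj 1 (-1) ≠ fj i 0 := fun i h => by
    have := (fj_inj.1 h).2; omega
  have haL : bEdgeQ (Nc δ) ∉ List.zipWith (fun u w => s(u, w)) (rowWalk (2 * N))
      (rowWalk (2 * N)).tail := by
    intro h
    obtain ⟨i, -, he⟩ := hmem _ h (fj (2 * Nc δ + 1) (-1)) (by unfold bEdgeQ; exact Sym2.mem_mk_right _ _)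
    exact hout i he
  have hab : bEdgeQ (Nc δ) ≠ bEdge := by
    intro h
    have : fj (2 * Nc δ) 0 ∈ bEdge := by rw [← h]; unfold bEdgeQ; exact Sym2.mem_mk_left _ _
    unfold bEdge at this
    rcases Sym2.mem_iff.1 this with h' | h'
    · have := (fj_inj.1 h').1; omega
    · have := (fj_inj.1 h').2; omega
  have hbL : bEdge ∉ List.zipWith (fun u w => s(u, w)) (rowWalk (2 * N)) (rowWalk (2 * N)).tail := by
    intro he
    obtain ⟨i, -, he'⟩ := hmem _ he (fj 1 (-1)) (by exact Sym2.mem_mk_right _ _)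
    exact hout' i he'
  have hadj : hexGraph.Adj (fj (2 * Nc δ) 0) (fj (2 * Nc δ + 1) (-1)) := by
    have h := adj_fj_down (show (2 * Nc δ) % 2 = 0 by omega) 0
    rwa [show (0 : ℤ) - 1 = -1 by norm_num] at h
  refine ⟨{ verts := rowWalk (2 * N)
            subset := fun v hv => ?_
            nodup := nodup_rowWalk _
            isChain := isChain_rowWalk _
            head_mem := fun v hv => ?_
            getLast_mem := fun v hv => ?_
            eq_of_nil := fun h => (rowWalk_ne_nil _ h).elim
            edges_nodup := fun _ => ?_
            fst_mem := ⟨(SimpleGraph.mem_edgeSet hexGraph).2 hadj, fj (2 * Nc δ) 0,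
              by unfold bEdgeQ; exact Sym2.mem_mk_left _ _, fj_two_Nc_mem hδ hδ'⟩ }⟩
  · obtain ⟨i, hi, rfl⟩ := mem_rowWalk.1 hv
    exact hΛ i hi
  · rw [head?_rowWalk, Option.some_inj] at hv
    subst hv
    unfold bEdgeQ
    rw [← hN]; push_cast
    exact Sym2.mem_mk_left _ _
  · rw [getLast?_rowWalk, Option.some_inj] at hv
    subst hv
    exact Sym2.mem_mk_left _ _
  · have hL := edges_nodup (nodup_rowWalk (2 * N))
    refine List.nodup_append.2 ⟨List.nodup_cons.2 ⟨haL, hL⟩, List.nodup_singleton _, ?_⟩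
    intro e he f hf
    rw [List.mem_singleton] at hf
    subst hf
    rcases List.mem_cons.1 he with rfl | he
    · exact hab
    · rintro rfl; exact hbL he

end Geometry

/-! ### The marked points `1/4` (root) and `0` (normalisation): balls and flatness (rev-4 `Fin 2` form) -/

/-- The quarter-balls about the two marked points of `(HD; 1/4, 0)` lie in the half-ball `B(0, 1/2)`,
where the body is the exact half-lattice. [folklore] -/
theorem ball_pt_quarter_subset (i : Fin 2) :
    Metric.ball ((halfDiscDomain (1 / 4) quarter_mem).pt i) (1 / 4) ⊆ Metric.ball (0 : ℂ) (1 / 2) := by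
  fin_cases i
  · change Metric.ball ((halfDiscDomain (1 / 4) quarter_mem).pt 0) (1 / 4) ⊆ _
    rw [pt_zero_halfDiscDomain]
    exact ball_quarter_subset
  · change Metric.ball ((halfDiscDomain (1 / 4) quarter_mem).pt 1) (1 / 4) ⊆ _
    rw [pt_one_halfDiscDomain]
    exact Metric.ball_subset_ball (by norm_num)

/-- **Every inner hypothesis of the rev-4 `HexObservableLimit` holds for the floor-rooted body family
on `(HD; 1/4, 0)`** — stated against the literal hypothesis list of item stmt-CriticalPhenomena-14003
(`ρ = 1/4`, `Λ δ = Lam δ false`, `m ≡ 0`, `a δ = bEdgeQ (Nc δ)`, `b δ = bEdge`, `Φ = Φ_{1/4}`,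
`L = Lfun (1/4)`, `Lb = Lfun (1/4) 0`; the three clauses on `ψ` are the caller's). [folklore] -/
theorem floorInstance_hypotheses :
    let D := halfDiscDomain (1 / 4) quarter_mem
    (0 : ℝ) < 1 / 4 ∧
    (∀ i : Fin 2, D.carrier ∩ Metric.ball (D.pt i) (1 / 4) =
      {z : ℂ | (D.pt i).im < z.im} ∩ Metric.ball (D.pt i) (1 / 4)) ∧
    (∀ᶠ δ : ℝ in 𝓝[>] 0,
      hexDomainSimplyConnected (Lam δ false) ∧ bEdgeQ (Nc δ) ∈ hexDomainBoundary (Lam δ false) ∧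
      bEdge ∈ hexDomainBoundary (Lam δ false) ∧
      Nonempty (HexMidEdgeSAW (Lam δ false) (bEdgeQ (Nc δ)) bEdge) ∧
      (hexGraph.induce ((Lam δ false : Finset HexVertex) : Set HexVertex)).Preconnected ∧
      (∀ v ∈ Lam δ false, (δ : ℂ) * hexCenter v ∈ D.carrier) ∧
      (∀ i : Fin 2, ∀ v : HexVertex, (δ : ℂ) * hexCenter v ∈ Metric.ball (D.pt i) (1 / 4) →
        (v ∈ Lam δ false ↔ (0 : ℤ) ≤ v.1 1))) ∧
    (∀ K : Set ℂ, IsCompact K → K ⊆ D.carrier →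
      ∀ᶠ δ : ℝ in 𝓝[>] 0, ∀ v : HexVertex, (δ : ℂ) * hexCenter v ∈ K → v ∈ Lam δ false) ∧
    Tendsto (fun δ : ℝ => (δ : ℂ) * hexMidpoint (bEdgeQ (Nc δ))) (𝓝[>] 0) (𝓝 (D.pt 0)) ∧
    Tendsto (fun δ : ℝ => (δ : ℂ) * hexMidpoint bEdge) (𝓝[>] 0) (𝓝 (D.pt 1)) ∧
    Tendsto (fun x => ‖PhiCE (1 / 4) quarter_mem x‖) (𝓝[D.carrier] (D.pt 0)) atTop ∧
    (PhiCE (1 / 4) quarter_mem).HasBoundaryValue (D.pt 1) 0 ∧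
    ContinuousOn (Lfun (1 / 4)) D.carrier ∧
    (∀ z ∈ D.carrier, Complex.exp (Lfun (1 / 4) z) = deriv (PhiCE (1 / 4) quarter_mem) z) ∧
    Tendsto (Lfun (1 / 4)) (𝓝[D.carrier] (D.pt 1)) (𝓝 (Lfun (1 / 4) 0)) := by
  intro D
  have hq := quarter_mem
  refine ⟨by norm_num, flat_quarter, ?_, ?_, ?_, ?_, ?_, ?_, continuousOn_Lfun hq,
    fun z hz => exp_Lfun hq hz, ?_⟩
  · -- the discrete hypotheses, for `0 < δ ≤ 1/16`
    filter_upwards [eventually_small one_pos] with δ hδ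
    obtain ⟨hδ, hδ', -⟩ := hδ
    refine ⟨simplyConnected_Lam hδ hδ' false, bEdgeQ_mem_boundary hδ hδ' false,
      bEdge_mem_boundary hδ hδ' false, nonempty_floorSAW hδ hδ', preconnected_Lam hδ hδ' false,
      fun v hv => smul_center_mem_HD hδ hδ' false hv, fun i v hv => ?_⟩
    exact mem_Lam_iff_of_ball hδ hδ' false (ball_pt_quarter_subset i hv)
  · -- exhaustion of compacts
    intro K hK hKD
    obtain ⟨ε, hε, -, hthick⟩ := exists_thick_of_isCompact hK hKD
    filter_upwards [eventually_small (by positivity : 0 < ε / 4)] with δ hδ v hv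
    obtain ⟨hδ, hδ', hδε⟩ := hδ
    obtain ⟨hn, hi⟩ := hthick _ hv
    exact mem_Lam_of_thick hδ hδ' false hδε hn hi
  · show Tendsto (fun δ : ℝ => (δ : ℂ) * hexMidpoint (bEdgeQ (Nc δ))) (𝓝[>] 0)
      (𝓝 ((halfDiscDomain (1 / 4) quarter_mem).pt 0))
    rw [pt_zero_halfDiscDomain]
    exact tendsto_smul_midpoint_bEdgeQ
  · show Tendsto (fun δ : ℝ => (δ : ℂ) * hexMidpoint bEdge) (𝓝[>] 0)
      (𝓝 ((halfDiscDomain (1 / 4) quarter_mem).pt 1))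
    rw [pt_one_halfDiscDomain]
    exact tendsto_smul_midpoint_bEdge
  · show Tendsto (fun x => ‖PhiCE (1 / 4) quarter_mem x‖)
      (𝓝[HD] ((halfDiscDomain (1 / 4) quarter_mem).pt 0)) atTop
    rw [pt_zero_halfDiscDomain]
    exact tendsto_norm_PhiCE hq
  · show (PhiCE (1 / 4) quarter_mem).HasBoundaryValue ((halfDiscDomain (1 / 4) quarter_mem).pt 1) 0
    rw [pt_one_halfDiscDomain]
    exact tendsto_PhiCE_zero hq
  · show Tendsto (Lfun (1 / 4)) (𝓝[HD] ((halfDiscDomain (1 / 4) quarter_mem).pt 1)) (𝓝 (Lfun (1 / 4) 0))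
    rw [pt_one_halfDiscDomain]
    exact tendsto_Lfun_zero hq

/-- **The hypothesis class of the rev-4 `HexObservableLimit` (item stmt-CriticalPhenomena-14003) is
inhabited**: some `(D, ρ, Λ, m, a, b, Φ, L, Lb, ψ)` satisfies all sixteen inner hypotheses (the floor-rooted
body family on `(HD; 1/4, 0)`, `ψ = 0`).  So the statement is a genuine `∀` over a nonempty class — not
provable by vacuity — and every line stub consuming it has contentful instances. [folklore] -/
theorem hexObservableLimit_hypotheses_inhabited :
    ∃ (D : DobrushinDomain) (ρ : ℝ) (Λ : ℝ → Finset HexVertex) (m : Fin 2 → ℝ → ℤ)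
      (a b : ℝ → Sym2 HexVertex) (Φ : ConformalEquiv D.carrier upperHalfPlaneSet) (L : ℂ → ℂ) (Lb : ℂ)
      (ψ : ℂ → ℂ),
      0 < ρ ∧
      (∀ i : Fin 2, D.carrier ∩ Metric.ball (D.pt i) ρ = {z : ℂ | (D.pt i).im < z.im} ∩ Metric.ball (D.pt i) ρ) ∧
      (∀ᶠ δ : ℝ in 𝓝[>] 0,
        hexDomainSimplyConnected (Λ δ) ∧ a δ ∈ hexDomainBoundary (Λ δ) ∧ b δ ∈ hexDomainBoundary (Λ δ) ∧
        Nonempty (HexMidEdgeSAW (Λ δ) (a δ) (b δ)) ∧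
        (hexGraph.induce ((Λ δ : Finset HexVertex) : Set HexVertex)).Preconnected ∧
        (∀ v ∈ Λ δ, (δ : ℂ) * hexCenter v ∈ D.carrier) ∧
        (∀ i : Fin 2, ∀ v : HexVertex, (δ : ℂ) * hexCenter v ∈ Metric.ball (D.pt i) ρ →
          (v ∈ Λ δ ↔ m i δ ≤ v.1 1))) ∧
      (∀ K : Set ℂ, IsCompact K → K ⊆ D.carrier →
        ∀ᶠ δ : ℝ in 𝓝[>] 0, ∀ v : HexVertex, (δ : ℂ) * hexCenter v ∈ K → v ∈ Λ δ) ∧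
      Tendsto (fun δ : ℝ => (δ : ℂ) * hexMidpoint (a δ)) (𝓝[>] 0) (𝓝 (D.pt 0)) ∧
      Tendsto (fun δ : ℝ => (δ : ℂ) * hexMidpoint (b δ)) (𝓝[>] 0) (𝓝 (D.pt 1)) ∧
      Tendsto (fun x => ‖Φ x‖) (𝓝[D.carrier] (D.pt 0)) atTop ∧
      Φ.HasBoundaryValue (D.pt 1) 0 ∧
      ContinuousOn L D.carrier ∧ (∀ z ∈ D.carrier, Complex.exp (L z) = deriv Φ z) ∧
      Tendsto L (𝓝[D.carrier] (D.pt 1)) (𝓝 Lb) ∧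
      Continuous ψ ∧ HasCompactSupport ψ ∧ tsupport ψ ⊆ D.carrier := by
  obtain ⟨h1, h2, h3, h4, h5, h6, h7, h8, h9, h10, h11⟩ := floorInstance_hypotheses
  refine ⟨halfDiscDomain (1 / 4) quarter_mem, 1 / 4, fun δ => Lam δ false, fun _ _ => 0,
    fun δ => bEdgeQ (Nc δ), fun _ => bEdge, PhiCE (1 / 4) quarter_mem, Lfun (1 / 4), Lfun (1 / 4) 0,
    0, h1, h2, h3, h4, h5, h6, h7, h8, h9, h10, h11, continuous_const, ?_, ?_⟩
  · exact HasCompactSupport.zero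
  · rw [tsupport, Function.support_zero, closure_empty]; exact empty_subset _

/-- **`HexObservableLimit` applied to the floor-rooted body family**: the universal constant `c ≠ 0` of
the rev-4 statement gives, for every bump `ψ` of the half-disc, the limit
`δ² Σ_e ψ(δ e) F_δ(e) / F_δ(bEdge) → c ∫ ψ exp((5/8)(L_{1/4} − L_{1/4} 0))` for the discretisation
`Lam δ false` rooted at the floor mid-edge `bEdgeQ (Nc δ) → 1/4` and normalised at `bEdge → 0`.
Any second refutation of item 14003 has to pair this typed instance with a competing one. [folklore] -/
theorem floorInstance_of_hexObservableLimit
    (h : Summit.CriticalPhenomena.SAWScalingLimit.Theses.SAWDevelopingMap.HexObservableLimit) :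
    ∃ c : ℂ, c ≠ 0 ∧ ∀ ψ : ℂ → ℂ, Continuous ψ → HasCompactSupport ψ → tsupport ψ ⊆ HD →
      Tendsto (fun δ : ℝ => (δ : ℂ) ^ 2 * (∑ᶠ e ∈ hexDomainMidEdges (Lam δ false),
          ψ ((δ : ℂ) * hexMidpoint e) *
            hexParafermionicObservable (Lam δ false) (bEdgeQ (Nc δ)) hexCriticalFugacity (5 / 8) e) /
          hexParafermionicObservable (Lam δ false) (bEdgeQ (Nc δ)) hexCriticalFugacity (5 / 8) bEdge)
        (𝓝[>] 0)
        (𝓝 (c * ∫ z, ψ z * Complex.exp ((5 / 8 : ℂ) * (Lfun (1 / 4) z - Lfun (1 / 4) 0)))) := by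
  obtain ⟨c, hc, H⟩ := h
  refine ⟨c, hc, fun ψ hψc hψK hψD => ?_⟩
  obtain ⟨h1, h2, h3, h4, h5, h6, h7, h8, h9, h10, h11⟩ := floorInstance_hypotheses
  exact H (halfDiscDomain (1 / 4) quarter_mem) (1 / 4) (fun δ => Lam δ false) (fun _ _ => 0)
    (fun δ => bEdgeQ (Nc δ)) (fun _ => bEdge) (PhiCE (1 / 4) quarter_mem) (Lfun (1 / 4)) (Lfun (1 / 4) 0)
    ψ h1 h2 h3 h4 h5 h6 h7 h8 h9 h10 h11 hψc hψK hψD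

end Summit.CriticalPhenomena.SAWScalingLimit.Theorems.ObservableToSLE.Negative

end
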